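import Mathlib.Analysis.SpecialFunctions.Pow.Deriv
import Mathlib.Analysis.SpecialFunctions.Complex.LogDeriv
import HarnessLib

/-!
# Gluing the two slit branches of `√(z - c) · g` into a single-valued function

Topic `Literature/Analysis/Complex` (elementary complex analysis; used for the spinor observables of
the planar Ising model, Chelkak–Hongler–Izyurov 2015, §3.4: "`√(z-a)·f̃` is single-valued near `a`").

A *spinor* `g` branching at `c` is known through two holomorphic sheets: `g₋` on the disc slit along
the LEFTWARD horizontal ray from `c`, `g₊` on the disc slit along the RIGHTWARD ray, with
`g₊ = g₋` on the open upper half-disc and `g₊ = -g₋` on the open lower half-disc. Then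
`k := (z-c)^{1/2} g₋` (principal branch, holomorphic off the leftward ray) and `i (c-z)^{1/2} g₊`
(holomorphic off the rightward ray) AGREE off the horizontal line, so they glue to a holomorphic
function `sqrtGlue c g₋ g₊` on the punctured set with `k² = (z - c) g²`.

* `I_mul_neg_cpow_half_of_im_pos/neg` — `i(-x)^{1/2} = ± x^{1/2}` according to the sign of `Im x`;
* `sqrtGlue`, `sqrtGlue_of_not_left`, `sqrtGlue_of_not_right`, `sqrtGlue_sq_of_not_left/right`,
  `differentiableOn_sqrtGlue`.

Everything is proved; [folklore].

## References

* D. Chelkak, C. Hongler, K. Izyurov, Ann. of Math. 181 (2015), §3.4 (single-valuedness of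
  `√(z-a) f̃`) [ChelkakHonglerIzyurovAnnals2015].
* L. V. Ahlfors, *Complex Analysis* (1979), Ch. 3 §4.2 (branches of `√`) [Ahlfors1979].
-/

noncomputable section

namespace Literature.Analysis.Complex

open Set Filter Metric _root_.Topology _root_.Complex
open scoped Real

/-! ### The principal square root on the two slit planes -/

/-- Off the leftward horizontal ray from `c`, `z - c` lies in the slit plane. [folklore] -/
theorem sub_mem_slitPlane_of_not_left {c z : ℂ} (h : ¬(z.im = c.im ∧ z.re ≤ c.re)) : z - c ∈ slitPlane := by
  rw [mem_slitPlane_iff, sub_re, sub_im]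
  by_cases him : z.im = c.im
  · left
    have : ¬z.re ≤ c.re := fun hre => h ⟨him, hre⟩
    push Not at this; linarith
  · right; exact sub_ne_zero.2 him

/-- Off the rightward horizontal ray from `c`, `c - z` lies in the slit plane. [folklore] -/
theorem sub_mem_slitPlane_of_not_right {c z : ℂ} (h : ¬(z.im = c.im ∧ c.re ≤ z.re)) : c - z ∈ slitPlane := by
  rw [mem_slitPlane_iff, sub_re, sub_im]
  by_cases him : z.im = c.im
  · left
    have : ¬c.re ≤ z.re := fun hre => h ⟨him, hre⟩
    push Not at this; linarith
  · right; exact sub_ne_zero.2 (Ne.symm him)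

/-- `exp (-(πi/2)) = -i`. [folklore] -/
theorem exp_neg_pi_div_two_mul_I : exp (-(π * I / 2)) = -I := by
  rw [show -((π : ℂ) * I / 2) = ((-(π / 2) : ℝ) : ℂ) * I by push_cast; ring, exp_mul_I]
  rw [← Complex.ofReal_cos, ← Complex.ofReal_sin, Real.cos_neg, Real.sin_neg, Real.cos_pi_div_two, Real.sin_pi_div_two]
  push_cast; ring

/-- `exp (πi/2) = i`. [folklore] -/
theorem exp_pi_div_two_mul_I : exp (π * I / 2) = I := by
  rw [show ((π : ℂ) * I / 2) = (((π / 2) : ℝ) : ℂ) * I by push_cast; ring, exp_mul_I]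
  rw [← Complex.ofReal_cos, ← Complex.ofReal_sin, Real.cos_pi_div_two, Real.sin_pi_div_two]
  push_cast; ring

/-- **`i (-x)^{1/2} = x^{1/2}` in the upper half-plane** (principal branches). [folklore] -/
theorem I_mul_neg_cpow_half_of_im_pos {x : ℂ} (hx : 0 < x.im) : I * (-x) ^ ((2 : ℂ)⁻¹) = x ^ ((2 : ℂ)⁻¹) := by
  have hx0 : x ≠ 0 := fun h => by rw [h] at hx; simp at hx
  -- `log (-x) = log x - πi` in the upper half-plane
  have hlog : log (-x) = log x - π * I := by
    apply Complex.ext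
    · simp [log_re, norm_neg]
    · simp [log_im, arg_neg_eq_arg_sub_pi_of_im_pos hx]
  rw [cpow_def_of_ne_zero (neg_ne_zero.2 hx0), cpow_def_of_ne_zero hx0, hlog, sub_mul, exp_sub,
    show (π : ℂ) * I * (2 : ℂ)⁻¹ = π * I / 2 by ring, exp_pi_div_two_mul_I]
  field_simp

/-- **`i (-x)^{1/2} = -x^{1/2}` in the lower half-plane** (principal branches). [folklore] -/
theorem I_mul_neg_cpow_half_of_im_neg {x : ℂ} (hx : x.im < 0) : I * (-x) ^ ((2 : ℂ)⁻¹) = -x ^ ((2 : ℂ)⁻¹) := by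
  have hx0 : x ≠ 0 := fun h => by rw [h] at hx; simp at hx
  -- `log (-x) = log x + πi` in the lower half-plane (also `RandomPlanarGeometry.log_neg_of_im_neg`)
  have hlog : log (-x) = log x + π * I := by
    apply Complex.ext
    · simp [log_re, norm_neg]
    · simp [log_im, arg_neg_eq_arg_add_pi_of_im_neg hx]
  rw [cpow_def_of_ne_zero (neg_ne_zero.2 hx0), cpow_def_of_ne_zero hx0, hlog, add_mul, exp_add,
    show (π : ℂ) * I * (2 : ℂ)⁻¹ = π * I / 2 by ring, exp_pi_div_two_mul_I]
  ring_nf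
  rw [I_sq]; ring

/-! ### The glued function -/

/-- **The single-valued product `√(z-c)·g`** of a spinor given by its two slit sheets `g₋` (off the
leftward ray) and `g₊` (off the rightward ray): `(z-c)^{1/2} g₋(z)` off the leftward ray and
`i (c-z)^{1/2} g₊(z)` on it. [cite: ChelkakHonglerIzyurovAnnals2015, §3.4] -/
def sqrtGlue (c : ℂ) (gm gp : ℂ → ℂ) (z : ℂ) : ℂ :=
  if z.im = c.im ∧ z.re ≤ c.re then I * (c - z) ^ ((2 : ℂ)⁻¹) * gp z else (z - c) ^ ((2 : ℂ)⁻¹) * gm z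

variable {c : ℂ} {gm gp : ℂ → ℂ} {U : Set ℂ}

/-- Off the leftward ray the glued function is `(z-c)^{1/2} g₋`. [folklore] -/
theorem sqrtGlue_of_not_left {z : ℂ} (h : ¬(z.im = c.im ∧ z.re ≤ c.re)) :
    sqrtGlue c gm gp z = (z - c) ^ ((2 : ℂ)⁻¹) * gm z := by
  rw [sqrtGlue, if_neg h]

/-- **Off the rightward ray the glued function is `i (c-z)^{1/2} g₊`**, given the sheet relations
`g₊ = g₋` above and `g₊ = -g₋` below the horizontal through `c`. [folklore] -/
theorem sqrtGlue_of_not_right (hup : ∀ z ∈ U, c.im < z.im → gp z = gm z) (hdn : ∀ z ∈ U, z.im < c.im → gp z = -gm z)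
    {z : ℂ} (hz : z ∈ U) (h : ¬(z.im = c.im ∧ c.re ≤ z.re)) :
    sqrtGlue c gm gp z = I * (c - z) ^ ((2 : ℂ)⁻¹) * gp z := by
  by_cases hl : z.im = c.im ∧ z.re ≤ c.re
  · rw [sqrtGlue, if_pos hl]
  · rw [sqrtGlue, if_neg hl]
    have him : z.im ≠ c.im := fun him => by
      rcases le_total z.re c.re with hre | hre
      · exact hl ⟨him, hre⟩
      · exact h ⟨him, hre⟩
    have hcz : c - z = -(z - c) := by ring
    rcases lt_or_gt_of_ne him with hlt | hgt
    · have h1 : (z - c).im < 0 := by rw [sub_im]; linarith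
      rw [hdn z hz hlt, hcz, show I * (-(z - c)) ^ ((2 : ℂ)⁻¹) * -gm z = -(I * (-(z - c)) ^ ((2 : ℂ)⁻¹)) * gm z by ring,
        I_mul_neg_cpow_half_of_im_neg h1, neg_neg]
    · have h1 : 0 < (z - c).im := by rw [sub_im]; linarith
      rw [hup z hz hgt, hcz, I_mul_neg_cpow_half_of_im_pos h1]

/-- Off the leftward ray, `sqrtGlue² = (z-c) g₋²`. [folklore] -/
theorem sqrtGlue_sq_of_not_left {z : ℂ} (h : ¬(z.im = c.im ∧ z.re ≤ c.re)) :
    sqrtGlue c gm gp z ^ 2 = (z - c) * gm z ^ 2 := by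
  -- `(w^{1/2})² = w` (also `LatticeModels.cpow_two_inv_sq`)
  have hsq : ((z - c) ^ ((2 : ℂ)⁻¹)) ^ 2 = z - c := by
    have h := Complex.cpow_nat_inv_pow (z - c) two_ne_zero
    have e : ((2 : ℕ) : ℂ)⁻¹ = (2 : ℂ)⁻¹ := by norm_num
    rwa [e] at h
  rw [sqrtGlue_of_not_left h, mul_pow, hsq]

/-- Off the rightward ray, `sqrtGlue² = (z-c) g₊²`. [folklore] -/
theorem sqrtGlue_sq_of_not_right (hup : ∀ z ∈ U, c.im < z.im → gp z = gm z) (hdn : ∀ z ∈ U, z.im < c.im → gp z = -gm z)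
    {z : ℂ} (hz : z ∈ U) (h : ¬(z.im = c.im ∧ c.re ≤ z.re)) :
    sqrtGlue c gm gp z ^ 2 = (z - c) * gp z ^ 2 := by
  have hsq : ((c - z) ^ ((2 : ℂ)⁻¹)) ^ 2 = c - z := by
    have h := Complex.cpow_nat_inv_pow (c - z) two_ne_zero
    have e : ((2 : ℕ) : ℂ)⁻¹ = (2 : ℂ)⁻¹ := by norm_num
    rwa [e] at h
  rw [sqrtGlue_of_not_right hup hdn hz h, mul_pow, mul_pow, hsq, I_sq]
  ring

/-- The square of the glued function off the centre, for a single-valued square `q = g₋² = g₊²`. [folklore] -/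
theorem sqrtGlue_sq (hup : ∀ z ∈ U, c.im < z.im → gp z = gm z) (hdn : ∀ z ∈ U, z.im < c.im → gp z = -gm z)
    {q : ℂ → ℂ} (hqm : ∀ z ∈ U, ¬(z.im = c.im ∧ z.re ≤ c.re) → q z = gm z ^ 2)
    (hqp : ∀ z ∈ U, ¬(z.im = c.im ∧ c.re ≤ z.re) → q z = gp z ^ 2) {z : ℂ} (hz : z ∈ U) (hzc : z ≠ c) :
    sqrtGlue c gm gp z ^ 2 = (z - c) * q z := by
  by_cases hl : z.im = c.im ∧ z.re ≤ c.re
  · have hr : ¬(z.im = c.im ∧ c.re ≤ z.re) := by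
      rintro ⟨-, hre⟩
      exact hzc (Complex.ext (le_antisymm hl.2 hre) hl.1)
    rw [sqrtGlue_sq_of_not_right hup hdn hz hr, hqp z hz hr]
  · rw [sqrtGlue_sq_of_not_left hl, hqm z hz hl]

/-- The leftward ray is closed. [folklore] -/
theorem isClosed_leftRay (c : ℂ) : IsClosed {z : ℂ | z.im = c.im ∧ z.re ≤ c.re} :=
  (isClosed_eq continuous_im continuous_const).inter (isClosed_le continuous_re continuous_const)

/-- The rightward ray is closed. [folklore] -/
theorem isClosed_rightRay (c : ℂ) : IsClosed {z : ℂ | z.im = c.im ∧ c.re ≤ z.re} :=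
  (isClosed_eq continuous_im continuous_const).inter (isClosed_le continuous_const continuous_re)

/-- **The glued function is holomorphic on the punctured set.** [cite: ChelkakHonglerIzyurovAnnals2015, §3.4] -/
theorem differentiableOn_sqrtGlue (hU : IsOpen U)
    (hgm : DifferentiableOn ℂ gm (U \ {z | z.im = c.im ∧ z.re ≤ c.re}))
    (hgp : DifferentiableOn ℂ gp (U \ {z | z.im = c.im ∧ c.re ≤ z.re}))
    (hup : ∀ z ∈ U, c.im < z.im → gp z = gm z) (hdn : ∀ z ∈ U, z.im < c.im → gp z = -gm z) :
    DifferentiableOn ℂ (sqrtGlue c gm gp) (U \ {c}) := by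
  rintro z ⟨hzU, hzc⟩
  have hzc : z ≠ c := hzc
  by_cases hl : z.im = c.im ∧ z.re ≤ c.re
  · -- on the leftward ray: use the right-slit expression on a neighbourhood
    have hr : ¬(z.im = c.im ∧ c.re ≤ z.re) := by
      rintro ⟨-, hre⟩
      exact hzc (Complex.ext (le_antisymm hl.2 hre) hl.1)
    have hV : U \ {w | w.im = c.im ∧ c.re ≤ w.re} ∈ 𝓝 z := (hU.sdiff (isClosed_rightRay c)).mem_nhds ⟨hzU, hr⟩
    have heq : sqrtGlue c gm gp =ᶠ[𝓝 z] fun w => I * (c - w) ^ ((2 : ℂ)⁻¹) * gp w := by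
      filter_upwards [hV] with w hw
      exact sqrtGlue_of_not_right hup hdn hw.1 hw.2
    have hd : DifferentiableAt ℂ (fun w => I * (c - w) ^ ((2 : ℂ)⁻¹) * gp w) z := by
      have h1 : DifferentiableAt ℂ (fun w => (c - w) ^ ((2 : ℂ)⁻¹)) z :=
        ((differentiableAt_const c).sub differentiableAt_id).cpow (differentiableAt_const _) (sub_mem_slitPlane_of_not_right hr)
      exact ((differentiableAt_const I).mul h1).mul ((hgp z ⟨hzU, hr⟩).differentiableAt hV)
    exact (heq.differentiableAt_iff.2 hd).differentiableWithinAt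
  · have hV : U \ {w | w.im = c.im ∧ w.re ≤ c.re} ∈ 𝓝 z := (hU.sdiff (isClosed_leftRay c)).mem_nhds ⟨hzU, hl⟩
    have heq : sqrtGlue c gm gp =ᶠ[𝓝 z] fun w => (w - c) ^ ((2 : ℂ)⁻¹) * gm w := by
      filter_upwards [hV] with w hw
      exact sqrtGlue_of_not_left hw.2
    have hd : DifferentiableAt ℂ (fun w => (w - c) ^ ((2 : ℂ)⁻¹) * gm w) z := by
      have h1 : DifferentiableAt ℂ (fun w => (w - c) ^ ((2 : ℂ)⁻¹)) z :=
        (differentiableAt_id.sub (differentiableAt_const c)).cpow (differentiableAt_const _) (sub_mem_slitPlane_of_not_left hl)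
      exact h1.mul ((hgm z ⟨hzU, hl⟩).differentiableAt hV)
    exact (heq.differentiableAt_iff.2 hd).differentiableWithinAt

/-- **Gluing, packaged**: a single-valued square `q` of a spinor known through its two slit sheets has
`(z - c) q = k²` on the punctured set for a holomorphic `k`. [cite: ChelkakHonglerIzyurovAnnals2015, §3.4] -/
theorem exists_sqrt_mul_of_sheets (hU : IsOpen U)
    (hgm : DifferentiableOn ℂ gm (U \ {z | z.im = c.im ∧ z.re ≤ c.re}))
    (hgp : DifferentiableOn ℂ gp (U \ {z | z.im = c.im ∧ c.re ≤ z.re}))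
    (hup : ∀ z ∈ U, c.im < z.im → gp z = gm z) (hdn : ∀ z ∈ U, z.im < c.im → gp z = -gm z)
    {q : ℂ → ℂ} (hqm : ∀ z ∈ U, ¬(z.im = c.im ∧ z.re ≤ c.re) → q z = gm z ^ 2)
    (hqp : ∀ z ∈ U, ¬(z.im = c.im ∧ c.re ≤ z.re) → q z = gp z ^ 2) :
    ∃ k : ℂ → ℂ, DifferentiableOn ℂ k (U \ {c}) ∧ ∀ z ∈ U \ {c}, (z - c) * q z = k z ^ 2 :=
  ⟨sqrtGlue c gm gp, differentiableOn_sqrtGlue hU hgm hgp hup hdn, fun _ hz =>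
    (sqrtGlue_sq hup hdn hqm hqp hz.1 hz.2).symm⟩

end Literature.Analysis.Complex
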